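import Summits.BirchSwinnertonDyer.BirchSwinnertonDyer.Theorems.KolyvaginDepthDoorMSymbolCertPeriods
import Literature.NumberTheory.EllipticCurves.KuriharaNumber
import Literature.NumberTheory.EllipticCurves.PAdicLFunctionProofs
import HarnessLib

/-!
# Route `KolyvaginDepthDoor`, crux `KolyvaginDepthSupplyKN` (stmt-BirchSwinnertonDyer-22820) —
# DEPTH TABLE v27, KIT 4/4: the mod-`p` KURIHARA NUMBER of a newform whose plus M-symbol is certified —
# `δ̃_n = (ε/2g) · K`, `K` a kernel-computable sum; hence `δ̃_n ≠ 0` from `K ≠ 0`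

Helper file of the lead prover of line `levelone` (kdd-p1 g31; `--supports stmt-BirchSwinnertonDyer-22820
--as helper`); it closes nothing and BSD is NOT proved by it.

* `tabFamily p T hT` — discrete logarithms `(ℤ/ℓ)ˣ → ℤ/p` given by TABLES `T ℓ` (validity `TabOK`, a
  decidable multiplicativity check; surjectivity from `tabSurj`), the explicit `ψ_ℓ` of the Kurihara sum.
* `sum_units_eq_sum_range` — `∑_{a ∈ (ℤ/n)ˣ} G(a) = ∑_{k < n, (k,n)=1} G(k)`.
* `not_dvd_of_norm_div_le_one` — `|ε S / d|_p ≤ 1`, `p ∤ S` ⟹ `p ∤ d` (the period normalisation is a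
  `p`-unit, fed by the tree's integrality theorem `IsNewformOf.norm_ratPlusSymbol_le_one`).
* `kuriharaNumber_eq_unit_mul_kSum` — if `[a/n]⁺_f = ε S(a)/(2g)` for all `a` prime to `n`, then
  `δ_n(f, p, ψ) = (ε / 2g) · kSum`, `kSum = ∑_{(k,n)=1} S(k) ∏_ℓ T_ℓ[k mod ℓ]` (mod `p`).
* `exists_kuriharaNumber_ne_zero` — THE ASSEMBLY: a certified line `re [e i]_f = t φ(i)` (kits 1–3), Bezout
  data, one `p`-adic unit value and `kSum ≠ 0` give `∃ ψ` surjective with `kuriharaNumber f p n ψ ≠ 0` — the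
  shape of `KuriharaCertificates.Record.Claim` / of the row hypotheses `hδ` of `…DepthTableKurihara`.

References: [Kim2022StructureSelmer] §1.4.3; [Kurihara2014] §1.1; [MazurTateTeitelbaum1986Invent] §I.8.
-/

set_option linter.dupNamespace false

noncomputable section

open scoped MatrixGroups ModularForm
open CongruenceSubgroup
open Literature.NumberTheory.EllipticCurves Literature.NumberTheory.EllipticCurves.ModularForms

namespace Summit.BirchSwinnertonDyer.BirchSwinnertonDyer.Theorems.KolyvaginDepthDoor.MSymbolCert

/-! ## §1 Discrete logarithms by table -/

section Tables

/-- The table value `T[a] mod p`. [folklore] -/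
def tabVal (tab : List ℕ) (p a : ℕ) : ZMod p := ((tab.getD a 0 : ℕ) : ZMod p)

/-- Multiplicativity check of a discrete-logarithm table modulo `ℓ`, values mod `p`:
`T[ab mod ℓ] ≡ T[a] + T[b]` for `0 < a, b < ℓ`. [folklore] -/
def tabOK (ℓ p : ℕ) (tab : List ℕ) : Bool :=
  (List.range ℓ).all fun a => (List.range ℓ).all fun b =>
    (a == 0) || (b == 0) || (tabVal tab p ((a * b) % ℓ) == tabVal tab p a + tabVal tab p b)

/-- Surjectivity check: every residue mod `p` is a table value at some `0 < a < ℓ`. [folklore] -/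
def tabSurj (ℓ p : ℕ) (tab : List ℕ) : Bool :=
  (List.range p).all fun r => (List.range ℓ).any fun a => (a != 0) && (tabVal tab p a == (r : ZMod p))

/-- Admissible table family: at every `ℓ` the table is empty or `ℓ` is prime and the table multiplicative.
(The unfolded content of `TabOK`; a `structure`-free conjunction.) [folklore] -/
theorem tabOK_nil (ℓ p : ℕ) : tabOK ℓ p [] = true := by
  unfold tabOK tabVal
  simp

variable (p : ℕ)

/-- **The table homomorphism** `(ℤ/ℓ)ˣ → ℤ/p`, `u ↦ T_ℓ[u]`, for a family of tables each empty or
multiplicative at a prime. [cite: Kurihara2014, §1.1] -/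
def tabFamily (T : ℕ → List ℕ) (hT : ∀ ℓ, T ℓ = [] ∨ (ℓ.Prime ∧ tabOK ℓ p (T ℓ) = true)) (ℓ : ℕ) :
    (ZMod ℓ)ˣ →* Multiplicative (ZMod p) where
  toFun u := Multiplicative.ofAdd (tabVal (T ℓ) p (u : ZMod ℓ).val)
  map_one' := by
    rcases hT ℓ with h | ⟨hℓ, h⟩
    · simp [h, tabVal]
    · haveI : Fact ℓ.Prime := ⟨hℓ⟩
      have h1 : ((1 : (ZMod ℓ)ˣ) : ZMod ℓ).val = 1 := by simp [ZMod.val_one]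
      rw [h1]
      simp only [tabOK, List.all_eq_true, List.mem_range, Bool.or_eq_true, beq_iff_eq] at h
      have := h 1 hℓ.one_lt 1 hℓ.one_lt
      simp only [one_ne_zero, false_or, mul_one, Nat.one_mod_eq_one.mpr hℓ.one_lt.ne'] at this
      have h0 : tabVal (T ℓ) p 1 = 0 := by
        have := this; rwa [left_eq_add] at this
      rw [h0]; rfl
  map_mul' u v := by
    rcases hT ℓ with h | ⟨hℓ, h⟩
    · simp [h, tabVal]
    · haveI : Fact ℓ.Prime := ⟨hℓ⟩
      rw [← ofAdd_add]
      congr 1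
      simp only [tabOK, List.all_eq_true, List.mem_range, Bool.or_eq_true, beq_iff_eq] at h
      have hu : (u : ZMod ℓ).val ≠ 0 := by
        rw [ne_eq, ZMod.val_eq_zero]; exact u.ne_zero
      have hv : (v : ZMod ℓ).val ≠ 0 := by
        rw [ne_eq, ZMod.val_eq_zero]; exact v.ne_zero
      have := h (u : ZMod ℓ).val (ZMod.val_lt _) (v : ZMod ℓ).val (ZMod.val_lt _)
      rcases this with (h0 | h0) | hmul
      · exact absurd h0 hu
      · exact absurd h0 hv
      · rw [Units.val_mul, ZMod.val_mul]
        exact hmul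

/-- Unfolding `tabFamily`. [folklore] -/
theorem tabFamily_apply (T : ℕ → List ℕ) (hT : ∀ ℓ, T ℓ = [] ∨ (ℓ.Prime ∧ tabOK ℓ p (T ℓ) = true))
    (ℓ : ℕ) (u : (ZMod ℓ)ˣ) :
    tabFamily p T hT ℓ u = Multiplicative.ofAdd (tabVal (T ℓ) p (u : ZMod ℓ).val) := rfl

/-- Surjectivity of the table homomorphism from the decidable check. [folklore] -/
theorem surjective_tabFamily (T : ℕ → List ℕ) (hT : ∀ ℓ, T ℓ = [] ∨ (ℓ.Prime ∧ tabOK ℓ p (T ℓ) = true))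
    {ℓ : ℕ} (hℓ : ℓ.Prime) [NeZero p] (hs : tabSurj ℓ p (T ℓ) = true) :
    Function.Surjective (tabFamily p T hT ℓ) := by
  intro y
  simp only [tabSurj, List.all_eq_true, List.mem_range, List.any_eq_true, Bool.and_eq_true, bne_iff_ne,
    ne_eq, beq_iff_eq] at hs
  obtain ⟨a, ha, ha0, hval⟩ := hs (Multiplicative.toAdd y).val (ZMod.val_lt _)
  have hcop : Nat.Coprime a ℓ := (Nat.coprime_of_lt_prime ha0 ha hℓ).symm
  refine ⟨ZMod.unitOfCoprime a hcop, ?_⟩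
  rw [tabFamily_apply, ZMod.coe_unitOfCoprime, ZMod.val_natCast, Nat.mod_eq_of_lt ha, hval,
    ZMod.natCast_zmod_val]
  rfl

end Tables

/-! ## §2 Sums over `(ℤ/n)ˣ` as sums over `{k < n : (k, n) = 1}` -/

/-- `∑_{a ∈ (ℤ/n)ˣ} G(a mod n) = ∑_{k < n} [(k,n) = 1] G(k)`. [folklore] -/
theorem sum_units_eq_sum_range {R : Type*} [AddCommMonoid R] (n : ℕ) [NeZero n] (G : ℕ → R) :
    ∑ a : (ZMod n)ˣ, G (a : ZMod n).val =
      ∑ k ∈ Finset.range n, if Nat.Coprime k n then G k else 0 := by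
  classical
  rw [← Equiv.sum_comp ZMod.unitsEquivCoprime.symm (fun a : (ZMod n)ˣ => G (a : ZMod n).val)]
  have h1 : ∀ x : {x : ZMod n // Nat.Coprime x.val n},
      G ((ZMod.unitsEquivCoprime.symm x : (ZMod n)ˣ) : ZMod n).val = G x.1.val := by
    intro x
    have : (ZMod.unitsEquivCoprime (ZMod.unitsEquivCoprime.symm x)) = x := Equiv.apply_symm_apply _ x
    have hx : ((ZMod.unitsEquivCoprime (ZMod.unitsEquivCoprime.symm x)) : {x : ZMod n // Nat.Coprime x.val n}).1
        = x.1 := by rw [this]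
    rw [← hx]
    rfl
  simp_rw [h1]
  rw [show (∑ x : {x : ZMod n // Nat.Coprime x.val n}, G x.1.val) =
      ∑ x ∈ (Finset.univ : Finset (ZMod n)).subtype (fun x => Nat.Coprime x.val n), G x.1.val by
    rw [Finset.subtype_univ], Finset.sum_subtype_eq_sum_filter (f := fun x : ZMod n => G x.val),
    Finset.sum_filter]
  obtain ⟨m, rfl⟩ := Nat.exists_eq_succ_of_ne_zero (NeZero.ne n)
  exact Fin.sum_univ_eq_sum_range (fun k => if Nat.Coprime k (m + 1) then G k else 0) (m + 1)

/-! ## §3 The normalisation is a `p`-adic unit -/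

/-- `|ε S / d|_p ≤ 1` with `p ∤ S`, `ε = ±1` forces `p ∤ d`. [folklore] -/
theorem not_dvd_of_norm_div_le_one (p : ℕ) [Fact p.Prime] (ε S : ℤ) (d : ℕ) (hd : 0 < d)
    (hε : ε = 1 ∨ ε = -1) (hS : ¬ (p : ℤ) ∣ S) (h : ‖(((ε * S / d : ℚ)) : ℚ_[p])‖ ≤ 1) : ¬ p ∣ d := by
  intro hpd
  have hεS : ¬ (p : ℤ) ∣ ε * S := by
    rcases hε with rfl | rfl <;> simpa using hS
  have h1 : ‖((ε * S : ℤ) : ℚ_[p])‖ = 1 :=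
    le_antisymm (Padic.norm_int_le_one _) (not_lt.mp fun hlt => hεS (Padic.norm_intCast_lt_one_iff.mp hlt))
  have h2 : ‖((d : ℕ) : ℚ_[p])‖ < 1 := Padic.norm_natCast_lt_one_iff.mpr hpd
  have h3 : ((ε * S / d : ℚ) : ℚ_[p]) = ((ε * S : ℤ) : ℚ_[p]) / ((d : ℕ) : ℚ_[p]) := by
    push_cast; ring
  rw [h3, norm_div, h1] at h
  have hdpos : 0 < ‖((d : ℕ) : ℚ_[p])‖ := norm_pos_iff.mpr (by exact_mod_cast hd.ne')
  rw [div_le_one hdpos] at h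
  linarith

/-! ## §4 The Kurihara number on a certified line -/

section Kurihara

variable {N : ℕ} (f : CuspForm (Gamma0 N) 2) (p : ℕ) [hp : Fact p.Prime] (n : ℕ) [NeZero n]

/-- The kernel's Kurihara sum: `∑_{k < n, (k,n)=1} S(k) · ∏_{ℓ ∈ P} T_ℓ[k mod ℓ]` in `ℤ/p`. [cite: Kim2022StructureSelmer, §1.4.3] -/
def kSum (S : ℕ → ℤ) (P : Finset ℕ) (T : ℕ → List ℕ) : ZMod p :=
  ∑ k ∈ Finset.range n, if Nat.Coprime k n then (S k : ZMod p) * ∏ ℓ ∈ P, tabVal (T ℓ) p (k % ℓ) else 0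

/-- **`δ_n = (ε/2g) · kSum`**: if `[k/n]⁺_f = ε S(k)/(2g)` for all `k < n` prime to `n`, with `p ∤ 2g`,
then the Kurihara number for the table logarithms is `(ε/2g) · kSum`. [cite: Kim2022StructureSelmer, §1.4.3] -/
theorem kuriharaNumber_eq_unit_mul_kSum (T : ℕ → List ℕ)
    (hT : ∀ ℓ, T ℓ = [] ∨ (ℓ.Prime ∧ tabOK ℓ p (T ℓ) = true)) (S : ℕ → ℤ) (ε : ℤ) (g : ℕ)
    (hg : ¬ p ∣ 2 * g)
    (hsym : ∀ k < n, Nat.Coprime k n → ratPlusSymbol f ((k : ℚ) / n) = ε * S k / (2 * g)) :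
    kuriharaNumber f p n (tabFamily p T hT) =
      ((ε : ZMod p) / ((2 * g : ℕ) : ZMod p)) * kSum p n S n.primeFactors T := by
  rw [kuriharaNumber_eq_sum_ratCast, kSum]
  have h2g : ((2 * g : ℕ) : ZMod p) ≠ 0 := by
    rw [ne_eq, ZMod.natCast_eq_zero_iff]; exact hg
  set u : ZMod p := (ε : ZMod p) / ((2 * g : ℕ) : ZMod p) with hu
  set G : ℕ → ZMod p := fun k => (S k : ZMod p) * ∏ ℓ ∈ n.primeFactors, tabVal (T ℓ) p (k % ℓ) with hG
  have hterm : ∀ a : (ZMod n)ˣ,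
      ((ratPlusSymbol f (((a : ZMod n).val : ℚ) / n) : ℚ) : ZMod p) *
        ∏ ℓ ∈ n.primeFactors.attach,
          Multiplicative.toAdd ((tabFamily p T hT ℓ.1) (ZMod.unitsMap (Nat.dvd_of_mem_primeFactors ℓ.2) a)) =
      u * G (a : ZMod n).val := by
    intro a
    have ha : (a : ZMod n).val < n := ZMod.val_lt _
    have hcop : Nat.Coprime (a : ZMod n).val n := ZMod.val_coe_unit_coprime a
    rw [hsym _ ha hcop]
    have hcast : (((ε * S (a : ZMod n).val / (2 * g) : ℚ)) : ZMod p) =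
        u * (S (a : ZMod n).val : ZMod p) := by
      have : (ε * S (a : ZMod n).val / (2 * g) : ℚ) =
          ((ε * S (a : ZMod n).val : ℤ) : ℚ) / ((2 * g : ℕ) : ℚ) := by
        push_cast; ring
      rw [this, Rat.cast_div_of_ne_zero, Rat.cast_intCast, Rat.cast_natCast, hu]
      · push_cast; ring
      · rw [Rat.den_intCast, Nat.cast_one]; exact one_ne_zero
      · rw [Rat.num_natCast, Int.cast_natCast]; exact h2g
    rw [hcast, hG]
    have hprod : ∀ ℓ ∈ n.primeFactors.attach,
        Multiplicative.toAdd ((tabFamily p T hT ℓ.1) (ZMod.unitsMap (Nat.dvd_of_mem_primeFactors ℓ.2) a)) =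
          tabVal (T ℓ.1) p ((a : ZMod n).val % ℓ.1) := by
      intro ℓ _
      haveI : NeZero ℓ.1 := ⟨(Nat.prime_of_mem_primeFactors ℓ.2).ne_zero⟩
      rw [tabFamily_apply, toAdd_ofAdd]
      congr 1
      rw [ZMod.unitsMap_def, Units.coe_map, MonoidHom.coe_coe, ZMod.castHom_apply, ZMod.cast_eq_val,
        ZMod.val_natCast]
    rw [Finset.prod_congr rfl hprod,
      Finset.prod_attach n.primeFactors (fun ℓ => tabVal (T ℓ) p ((a : ZMod n).val % ℓ))]
    simp only
    ring
  rw [Fintype.sum_congr _ _ hterm, ← Finset.mul_sum, sum_units_eq_sum_range n G]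

/-- **ASSEMBLY: a certified plus M-symbol gives a non-zero Kurihara number.** `f` the newform of `W`
(globally minimal, `E[p]` irreducible, `p` odd), level `N` prime, `n ≥ 1` prime to `N`; the real parts of
the M-symbols of `f` on the line through `φ` (`re [e i]_f = t φ(i)`, `i ≤ N` — kits 1–3); Bezout data
`w(k) = k^E mod n`; ONE value `S(a₀)` prime to `p`; table logarithms `T`; and `kSum ≠ 0`. Then
`∃ ψ` (surjective at the prime factors of `n`) with `kuriharaNumber f p n ψ ≠ 0`.
[cite: Kim2022StructureSelmer, §1.4.3] [cite: MazurTateTeitelbaum1986Invent, §I.8] -/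
theorem exists_kuriharaNumber_ne_zero [Fact N.Prime] {W : WeierstrassCurve ℚ} [W.IsElliptic]
    [W.IsGloballyMinimal] (hf : IsNewformOf W f) (hp2 : p ≠ 2) (hirr : W.HasIrreducibleModPGaloisRep p)
    (hnN : n.Coprime N) {φ : ℕ → ℤ} {t : ℝ} (hΨ : ∀ i ≤ N, Ψ f i = t * φ i)
    (E fuel : ℕ) (hfuel : n < fuel)
    (hw : ∀ k < n, Nat.Coprime k n → ((k : ℤ) * ((k ^ E % n : ℕ) : ℤ)) % n = 1)
    (a₀ : ℕ) (ha₀ : a₀ < n) (ha₀c : Nat.Coprime a₀ n)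
    (hunit : ¬ (p : ℤ) ∣ chainSum N φ fuel n ((a₀ ^ E % n : ℕ) : ℤ))
    (T : ℕ → List ℕ) (hT : ∀ ℓ, T ℓ = [] ∨ (ℓ.Prime ∧ tabOK ℓ p (T ℓ) = true))
    (hsurj : ∀ ℓ ∈ n.primeFactors, tabSurj ℓ p (T ℓ) = true)
    (hK : kSum p n (fun k => chainSum N φ fuel n ((k ^ E % n : ℕ) : ℤ)) n.primeFactors T ≠ 0) :
    ∃ ψ : (ℓ : ℕ) → (ZMod ℓ)ˣ →* Multiplicative (ZMod p),
      (∀ ℓ ∈ n.primeFactors, Function.Surjective (ψ ℓ)) ∧ kuriharaNumber f p n ψ ≠ 0 := by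
  have hf0 : IsNewform0 f := hf.1
  have hQ : coeffField f = ⊥ := hf.coeffField_eq_bot
  obtain ⟨g, ε, hg, hε, hval⟩ := exists_ratPlusSymbol_eq f hf0 hQ hΨ
  have hn : 0 < n := Nat.pos_of_ne_zero (NeZero.ne n)
  -- the symbol values at `k/n`
  have hsym : ∀ k < n, Nat.Coprime k n →
      ratPlusSymbol f ((k : ℚ) / n) = ε * chainSum N φ fuel n ((k ^ E % n : ℕ) : ℤ) / (2 * g) := by
    intro k hk hkc
    have := hval k ((k ^ E % n : ℕ) : ℤ) n hn (hw k hk hkc) fuel hfuel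
    rwa [Int.cast_natCast] at this
  -- `p ∤ 2g` from integrality at `a₀`
  have h2g : ¬ p ∣ 2 * g := by
    have hle : ‖((ratPlusSymbol f ((a₀ : ℚ) / n) : ℚ) : ℚ_[p])‖ ≤ 1 := by
      refine IsNewformOf.norm_ratPlusSymbol_le_one hf hp2 hirr ?_
      have hden : (((a₀ : ℚ) / n).den : ℤ) ∣ (n : ℤ) := by
        have := Rat.den_dvd (a₀ : ℤ) (n : ℤ)
        rwa [Rat.divInt_eq_div, Int.cast_natCast, Int.cast_natCast] at this
      have hden' : ((a₀ : ℚ) / n).den ∣ n := by exact_mod_cast hden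
      exact Nat.Coprime.coprime_dvd_left hden' hnN
    rw [hsym a₀ ha₀ ha₀c] at hle
    have := not_dvd_of_norm_div_le_one p ε _ (2 * g) (by omega) hε hunit (by push_cast at hle ⊢; exact hle)
    exact this
  refine ⟨tabFamily p T hT, fun ℓ hℓ => surjective_tabFamily p T hT (Nat.prime_of_mem_primeFactors hℓ) (hsurj ℓ hℓ), ?_⟩
  rw [kuriharaNumber_eq_unit_mul_kSum f p n T hT _ ε g h2g hsym]
  refine mul_ne_zero (div_ne_zero ?_ ?_) hK
  · rcases hε with rfl | rfl
    · simp
    · simp only [Int.reduceNeg, Int.cast_neg, Int.cast_one, ne_eq, neg_eq_zero]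
      exact one_ne_zero
  · rw [ne_eq, ZMod.natCast_eq_zero_iff]; exact h2g

end Kurihara

end Summit.BirchSwinnertonDyer.BirchSwinnertonDyer.Theorems.KolyvaginDepthDoor.MSymbolCert

end
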